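import Summits.Ventures.PercRepro.C041ThreeExitZone

/-!
# ROW C-041 — THE FOUR-EXIT ATTACHMENT and its zone sets at the anchor (p6, gen 31; groundwork for the r = 4 block
map — step (1) of the recipe in P6-TWOEXIT-LEAN.md §6)

`glue4 Z₁ u u' u'' u''' Z a Z' a' Z'' a'' Z''' a'''` hangs `Z'''` at `u'''` on the three-exit attachment — the anchor
gluing of `C041AnchorGlue` once more.  Every reach is inherited (`mem_K_glue3_iff`, `mem_P_glue3_iff`), and the zone
sets at the anchor read off the statuses of the four exits: `anchor₄_mem_D_iff` / `_D2_iff` (deleted iff some exit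
is merged with its zone's anchor deleted), `adm₄_iff` (the four zones admissible and none of the three junctions
deleted on both sides), `blueK₄_iff` (each reached exit's zone blue at its own `K`).
-/

namespace PercRepro

namespace ZoneZ

namespace TwoExit

open ZoneData Pendant AnchorGlue

variable {V₁ E₁ U₁ U₂ V E T₁ T₂ V' E' T₁' T₂' V'' E'' T₁'' T₂'' V''' E''' T₁''' T₂''' : Type}
variable (Z₁ : ZoneData V₁ E₁ U₁ U₂) (u u' u'' u''' : V₁) (Z : ZoneData V E T₁ T₂) (a : V)
  (Z' : ZoneData V' E' T₁' T₂') (a' : V') (Z'' : ZoneData V'' E'' T₁'' T₂'') (a'' : V'')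
  (Z''' : ZoneData V''' E''' T₁''' T₂''') (a''' : V''')

/-- THE FOUR-EXIT ATTACHMENT: `Z'` at `u'`, `Z` at `u`, `Z''` at `u''`, then `Z'''` at `u'''`. -/
noncomputable abbrev glue4 :
    ZoneData ((((V₁ ⊕ V') ⊕ V) ⊕ V'') ⊕ V''') ((((E₁ ⊕ E') ⊕ E) ⊕ E'') ⊕ E''') (((T₁' ⊕ T₁) ⊕ T₁'') ⊕ T₁''')
      (((T₂' ⊕ T₂) ⊕ T₂'') ⊕ T₂''') :=
  glue (glue3 Z₁ u u' u'' Z a Z' a' Z'' a'') (Sum.inl (Sum.inl (Sum.inl u'''))) Z''' a'''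

variable (σ : State ((((E₁ ⊕ E') ⊕ E) ⊕ E'') ⊕ E''') (((T₁' ⊕ T₁) ⊕ T₁'') ⊕ T₁''') (((T₂' ⊕ T₂) ⊕ T₂'') ⊕ T₂'''))

/-- The colouring of `Z₁` in a state of the four-exit attachment. -/
def col₁₄ : E₁ → Bool := col₁₃ (restrL σ)

/-- The state of `Z'`. -/
def st'₄ : State E' T₁' T₂' := st'₃ (restrL σ)

/-- The state of `Z`. -/
def st₄ : State E T₁ T₂ := st₃ (restrL σ)

/-- The state of `Z''`. -/
def st''₄ : State E'' T₁'' T₂'' := st''₃ (restrL σ)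

/-- The state of `Z'''`. -/
def st'''₄ : State E''' T₁''' T₂''' := restrR σ

variable (a₁ : V₁)

/-- The red reach of the anchor at a `Z₁`-vertex of the three-exit attachment: the reach inside `Z₁`. -/
theorem mem_K_glue3_iff (τ : State (((E₁ ⊕ E') ⊕ E) ⊕ E'') ((T₁' ⊕ T₁) ⊕ T₁'') ((T₂' ⊕ T₂) ⊕ T₂'')) (v : V₁) :
    Sum.inl (Sum.inl (Sum.inl v)) ∈ (glue3 Z₁ u u' u'' Z a Z' a' Z'' a'').K {Sum.inl (Sum.inl (Sum.inl a₁))} τ ↔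
      Z₁.Rd a₁ v (col₁₃ τ) := by
  rw [inl_mem_K_iff_of_anchor, mem_K_glue2_iff]
  rfl

/-- The blue reach of the three-exit attachment from `inl (inl (inl u'''))`, at a `Z₁`-vertex: blue connectivity
to `u'''` inside `Z₁`. -/
theorem mem_P_glue3_iff (τ : State (((E₁ ⊕ E') ⊕ E) ⊕ E'') ((T₁' ⊕ T₁) ⊕ T₁'') ((T₂' ⊕ T₂) ⊕ T₂'')) (v : V₁) :
    Sum.inl (Sum.inl (Sum.inl v)) ∈ (glue3 Z₁ u u' u'' Z a Z' a' Z'' a'').P {Sum.inl (Sum.inl (Sum.inl u'''))} τ ↔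
      Z₁.Mg v u''' (col₁₃ τ) := by
  unfold P BlueAdj
  rw [adj_eq_cAdj, AnchorGlue.inl_mem_reach_iff (glue2 Z₁ u u' Z a Z' a') (Sum.inl (Sum.inl u'')) Z'' a'' false τ _
    (by simp), junction_singleton_iff_of_anchor]
  have e1 : leftSet ({Sum.inl (Sum.inl (Sum.inl u'''))} : Set (((V₁ ⊕ V') ⊕ V) ⊕ V'')) =
      {Sum.inl (Sum.inl u''')} := by
    ext x
    simp [leftSet]
  rw [e1]
  have h1 := mem_P_glue2_iff Z₁ u u' u''' Z a Z' a' (restrL τ) v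
  have h2 := mem_P_glue2_iff Z₁ u u' u''' Z a Z' a' (restrL τ) u''
  have h3 := mem_P_glue2_iff Z₁ u u' u'' Z a Z' a' (restrL τ) v
  change (Sum.inl (Sum.inl v) ∈ (glue2 Z₁ u u' Z a Z' a').P {Sum.inl (Sum.inl u''')} (restrL τ) ∨
    (Sum.inl (Sum.inl u'') ∈ (glue2 Z₁ u u' Z a Z' a').P {Sum.inl (Sum.inl u''')} (restrL τ) ∧
      Sum.inl (Sum.inl v) ∈ (glue2 Z₁ u u' Z a Z' a').P {Sum.inl (Sum.inl u'')} (restrL τ))) ↔ _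
  rw [h1, h2, h3]
  constructor
  · rintro (h | ⟨hu, hv⟩)
    · exact h
    · exact Mg_trans Z₁ _ _ _ _ hv hu
  · intro h
    exact Or.inl h

/-- The junction `u'''` is deleted in the four-exit attachment iff `a'''` is deleted in `Z'''`, or some earlier
exit's zone has its anchor deleted with `u'''` blue-connected to that exit. -/
theorem junction₄_mem_D_iff :
    Sum.inl (Sum.inl (Sum.inl (Sum.inl u'''))) ∈ (glue4 Z₁ u u' u'' u''' Z a Z' a' Z'' a'' Z''' a''').D σ ↔
      (a' ∈ Z'.D (st'₄ σ) ∧ Z₁.Mg u''' u' (col₁₄ σ)) ∨ (a ∈ Z.D (st₄ σ) ∧ Z₁.Mg u''' u (col₁₄ σ)) ∨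
        (a'' ∈ Z''.D (st''₄ σ) ∧ Z₁.Mg u''' u'' (col₁₄ σ)) ∨ a''' ∈ Z'''.D (st'''₄ σ) := by
  rw [AnchorGlue.inl_a_mem_D_iff, anchor₃_mem_D_iff, or_assoc, or_assoc]
  rfl

/-- The junction `u'''` is deleted on side `2`. -/
theorem junction₄_mem_D2_iff :
    Sum.inl (Sum.inl (Sum.inl (Sum.inl u'''))) ∈ (glue4 Z₁ u u' u'' u''' Z a Z' a' Z'' a'' Z''' a''').D2 σ ↔
      (a' ∈ Z'.D2 (st'₄ σ) ∧ Z₁.Mg u''' u' (col₁₄ σ)) ∨ (a ∈ Z.D2 (st₄ σ) ∧ Z₁.Mg u''' u (col₁₄ σ)) ∨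
        (a'' ∈ Z''.D2 (st''₄ σ) ∧ Z₁.Mg u''' u'' (col₁₄ σ)) ∨ a''' ∈ Z'''.D2 (st'''₄ σ) := by
  rw [AnchorGlue.inl_a_mem_D2_iff, anchor₃_mem_D2_iff, or_assoc, or_assoc]
  rfl

/-- **The anchor is deleted** iff some exit is merged with its zone's anchor deleted. -/
theorem anchor₄_mem_D_iff :
    Sum.inl (Sum.inl (Sum.inl (Sum.inl a₁))) ∈ (glue4 Z₁ u u' u'' u''' Z a Z' a' Z'' a'' Z''' a''').D σ ↔
      (a' ∈ Z'.D (st'₄ σ) ∧ Z₁.Mg a₁ u' (col₁₄ σ)) ∨ (a ∈ Z.D (st₄ σ) ∧ Z₁.Mg a₁ u (col₁₄ σ)) ∨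
        (a'' ∈ Z''.D (st''₄ σ) ∧ Z₁.Mg a₁ u'' (col₁₄ σ)) ∨ (a''' ∈ Z'''.D (st'''₄ σ) ∧ Z₁.Mg a₁ u''' (col₁₄ σ)) := by
  rw [AnchorGlue.inl_mem_D_iff, junction₄_mem_D_iff, anchor₃_mem_D_iff, mem_P_glue3_iff]
  unfold st'₄ st₄ st''₄ col₁₄
  constructor
  · rintro (h | ⟨(⟨hD', hc⟩ | ⟨hD, hc⟩ | ⟨hD'', hc⟩ | hD'''), hm⟩)
    · rcases h with h | h | h
      · exact Or.inl h
      · exact Or.inr (Or.inl h)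
      · exact Or.inr (Or.inr (Or.inl h))
    · exact Or.inl ⟨hD', Mg_trans Z₁ _ _ _ _ hm hc⟩
    · exact Or.inr (Or.inl ⟨hD, Mg_trans Z₁ _ _ _ _ hm hc⟩)
    · exact Or.inr (Or.inr (Or.inl ⟨hD'', Mg_trans Z₁ _ _ _ _ hm hc⟩))
    · exact Or.inr (Or.inr (Or.inr ⟨hD''', hm⟩))
  · rintro (h | h | h | ⟨hD''', hm⟩)
    · exact Or.inl (Or.inl h)
    · exact Or.inl (Or.inr (Or.inl h))
    · exact Or.inl (Or.inr (Or.inr h))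
    · exact Or.inr ⟨Or.inr (Or.inr (Or.inr hD''')), hm⟩

/-- **The anchor is deleted on side `2`** iff some exit is merged with its zone's anchor deleted on side `2`. -/
theorem anchor₄_mem_D2_iff :
    Sum.inl (Sum.inl (Sum.inl (Sum.inl a₁))) ∈ (glue4 Z₁ u u' u'' u''' Z a Z' a' Z'' a'' Z''' a''').D2 σ ↔
      (a' ∈ Z'.D2 (st'₄ σ) ∧ Z₁.Mg a₁ u' (col₁₄ σ)) ∨ (a ∈ Z.D2 (st₄ σ) ∧ Z₁.Mg a₁ u (col₁₄ σ)) ∨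
        (a'' ∈ Z''.D2 (st''₄ σ) ∧ Z₁.Mg a₁ u'' (col₁₄ σ)) ∨
          (a''' ∈ Z'''.D2 (st'''₄ σ) ∧ Z₁.Mg a₁ u''' (col₁₄ σ)) := by
  rw [AnchorGlue.inl_mem_D2_iff, junction₄_mem_D2_iff, anchor₃_mem_D2_iff, mem_P_glue3_iff]
  unfold st'₄ st₄ st''₄ col₁₄
  constructor
  · rintro (h | ⟨(⟨hD', hc⟩ | ⟨hD, hc⟩ | ⟨hD'', hc⟩ | hD'''), hm⟩)
    · rcases h with h | h | h
      · exact Or.inl h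
      · exact Or.inr (Or.inl h)
      · exact Or.inr (Or.inr (Or.inl h))
    · exact Or.inl ⟨hD', Mg_trans Z₁ _ _ _ _ hm hc⟩
    · exact Or.inr (Or.inl ⟨hD, Mg_trans Z₁ _ _ _ _ hm hc⟩)
    · exact Or.inr (Or.inr (Or.inl ⟨hD'', Mg_trans Z₁ _ _ _ _ hm hc⟩))
    · exact Or.inr (Or.inr (Or.inr ⟨hD''', hm⟩))
  · rintro (h | h | h | ⟨hD''', hm⟩)
    · exact Or.inl (Or.inl h)
    · exact Or.inl (Or.inr (Or.inl h))
    · exact Or.inl (Or.inr (Or.inr h))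
    · exact Or.inr ⟨Or.inr (Or.inr (Or.inr hD''')), hm⟩

/-- **Admissibility of the four-exit attachment**: the four zones admissible and none of the three junctions
deleted on both sides (each junction collects its own zone's marks and, through blue paths to the earlier exits,
theirs). -/
theorem adm₄_iff :
    (glue4 Z₁ u u' u'' u''' Z a Z' a' Z'' a'' Z''' a''').adm σ ↔
      Z'.adm (st'₄ σ) ∧ Z.adm (st₄ σ) ∧ Z''.adm (st''₄ σ) ∧ Z'''.adm (st'''₄ σ) ∧
        ¬ (((a' ∈ Z'.D (st'₄ σ) ∧ Z₁.Mg u u' (col₁₄ σ)) ∨ a ∈ Z.D (st₄ σ)) ∧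
          ((a' ∈ Z'.D2 (st'₄ σ) ∧ Z₁.Mg u u' (col₁₄ σ)) ∨ a ∈ Z.D2 (st₄ σ))) ∧
        ¬ (((a' ∈ Z'.D (st'₄ σ) ∧ Z₁.Mg u'' u' (col₁₄ σ)) ∨ (a ∈ Z.D (st₄ σ) ∧ Z₁.Mg u'' u (col₁₄ σ)) ∨
            a'' ∈ Z''.D (st''₄ σ)) ∧
          ((a' ∈ Z'.D2 (st'₄ σ) ∧ Z₁.Mg u'' u' (col₁₄ σ)) ∨ (a ∈ Z.D2 (st₄ σ) ∧ Z₁.Mg u'' u (col₁₄ σ)) ∨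
            a'' ∈ Z''.D2 (st''₄ σ))) ∧
        ¬ (((a' ∈ Z'.D (st'₄ σ) ∧ Z₁.Mg u''' u' (col₁₄ σ)) ∨ (a ∈ Z.D (st₄ σ) ∧ Z₁.Mg u''' u (col₁₄ σ)) ∨
            (a'' ∈ Z''.D (st''₄ σ) ∧ Z₁.Mg u''' u'' (col₁₄ σ)) ∨ a''' ∈ Z'''.D (st'''₄ σ)) ∧
          ((a' ∈ Z'.D2 (st'₄ σ) ∧ Z₁.Mg u''' u' (col₁₄ σ)) ∨ (a ∈ Z.D2 (st₄ σ) ∧ Z₁.Mg u''' u (col₁₄ σ)) ∨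
            (a'' ∈ Z''.D2 (st''₄ σ) ∧ Z₁.Mg u''' u'' (col₁₄ σ)) ∨ a''' ∈ Z'''.D2 (st'''₄ σ))) := by
  rw [AnchorGlue.adm_iff, adm₃_iff, junction₄_mem_D_iff, junction₄_mem_D2_iff]
  unfold st'₄ st₄ st''₄ st'''₄ col₁₄
  tauto

/-- **Blue at `K` at the anchor**: each reached exit's zone is blue at its own `K`. -/
theorem blueK₄_iff :
    (glue4 Z₁ u u' u'' u''' Z a Z' a' Z'' a'' Z''' a''').blueK {Sum.inl (Sum.inl (Sum.inl (Sum.inl a₁)))} σ ↔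
      (Z₁.Rd a₁ u' (col₁₄ σ) → Z'.blueK {a'} (st'₄ σ)) ∧ (Z₁.Rd a₁ u (col₁₄ σ) → Z.blueK {a} (st₄ σ)) ∧
        (Z₁.Rd a₁ u'' (col₁₄ σ) → Z''.blueK {a''} (st''₄ σ)) ∧
          (Z₁.Rd a₁ u''' (col₁₄ σ) → Z'''.blueK {a'''} (st'''₄ σ)) := by
  rw [blueK_iff_of_anchor, blueK₃_iff, mem_K_glue3_iff]
  unfold st'₄ st₄ st''₄ st'''₄ col₁₄
  rw [and_assoc, and_assoc]

end TwoExit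

end ZoneZ

end PercRepro
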